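import Literature.Algebra.EuclideanLattices.LatticePointCounting
import HarnessLib

/-!
# Lattice points of a coset `v + L` in expanding domains with Lipschitz-parametrizable boundary

Topic `Literature/Algebra/EuclideanLattices` (geometry of numbers). Everything in this file is
PROVED (theorems only); it is the translation-uniform form of `LatticePointCounting.lean`.

For a full `ℤ`-lattice `L` in a real normed space `E` of dimension `n ≥ 1` with Haar measure `μ`
and a bounded `X ⊆ E` whose frontier is `(n−1)`-Lipschitz parametrizable
(`Literature.Algebra.EuclideanLattices.LipschitzFrontier`), the count of the points of **any coset** `v + L`
in `tX` has the same main term and an error bound *uniform in `v`*: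

  `|#((v + L) ∩ tX) − μ(X)/covol(L) · tⁿ| ≤ C t^{n−1}`   (`t ≥ 1`, all `v ∈ E`),

`abs_card_inter_smul_vadd_sub_le` (and the basis form `…_basis`, the cone form
`abs_card_sep_le_vadd_sub_le`).  Proof: `(v + L) ∩ tX` is in bijection with `L ∩ (−v + tX)` and
`frontier (−v + tX) = −v + frontier (tX)` is covered by the translates of the `≤ C t^{n−1}` unit
balls covering `frontier (tX)` (`LipschitzFrontier.exists_cover`), so the basic counting
inequality `abs_card_sub_div_le_of_cover` of `LatticePointCounting.lean` applies verbatim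
(Marcus, *Number Fields*, Ch. 6, Lemma 2, whose proof is translation invariant; Lang,
*Algebraic Number Theory*, VI §2, Thm. 2 states the count for translates `L + v` explicitly:
"the number of lattice points … in `tD + v` …" is `vol(D)/covol · tⁿ + O(t^{n−1})` uniformly).
This is the form needed to count integral ideals in a *ray class* (congruence conditions single
out cosets of a sublattice `𝔪J ⊆ J`).

## References

* D. A. Marcus, *Number Fields*, 2nd ed., Springer 2018, Ch. 6, Lemma 2. [Marcus2018]
* S. Lang, *Algebraic Number Theory*, 2nd ed., GTM 110, Springer 1994, Ch. VI §2, Theorem 2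
  (and §3, Theorem 3 for the application to generalized ideal classes).
-/

noncomputable section

open MeasureTheory Module Submodule Bornology Set Metric ZSpan
open scoped Pointwise NNReal ENNReal Topology

namespace Literature.Algebra.EuclideanLattices

section Coset

variable {E : Type*} [NormedAddCommGroup E] [NormedSpace ℝ E]
variable [MeasurableSpace E] [BorelSpace E] [FiniteDimensional ℝ E]
variable (μ : Measure E) [μ.IsAddHaarMeasure]

omit [NormedSpace ℝ E] [MeasurableSpace E] [BorelSpace E] [FiniteDimensional ℝ E] in
/-- The points of the coset `v + Λ` in `S` correspond to the points of `Λ` in `−v + S`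
(`x ↦ x − v`). [folklore] -/
theorem card_inter_vadd_eq (Λ : Set E) (S : Set E) (v : E) :
    Nat.card (S ∩ (v +ᵥ Λ) : Set E) = Nat.card (((-v) +ᵥ S) ∩ Λ : Set E) := by
  refine Nat.card_congr
    { toFun := fun x ↦ ⟨-v + (x : E), ?_, ?_⟩
      invFun := fun y ↦ ⟨v + (y : E), ?_, ?_⟩
      left_inv := fun x ↦ Subtype.ext (by simp)
      right_inv := fun y ↦ Subtype.ext (by simp) }
  · exact Set.vadd_mem_vadd_set x.2.1
  · obtain ⟨l, hl, hlx⟩ := Set.mem_vadd_set.mp x.2.2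
    rw [← hlx, vadd_eq_add, neg_add_cancel_left]
    exact hl
  · obtain ⟨s, hs, hsy⟩ := Set.mem_vadd_set.mp y.2.1
    rw [← hsy, vadd_eq_add, add_neg_cancel_left]
    exact hs
  · exact Set.mem_vadd_set.mpr ⟨y, y.2.2, rfl⟩

/-- **Coset points in `tX`, basis form**: for a real basis `b` of `E` with lattice
`Λ = span_ℤ b` and fundamental parallelepiped `P`, and `X` bounded with
`(n−1)`-Lipschitz-parametrizable frontier, there is `C` with
`|#((v + Λ) ∩ tX) − μ(X) tⁿ/μ(P)| ≤ C t^{n−1}` for all `t ≥ 1` and **all `v ∈ E`**.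
[cite: Marcus2018, Ch. 6, Lemma 2] -/
theorem abs_card_inter_smul_vadd_sub_le_basis {ι : Type*} [Fintype ι] (b : Basis ι ℝ E)
    {X : Set E} (hX₁ : IsBounded X) (hX₂ : LipschitzFrontier X) :
    ∃ C : ℝ, ∀ t : ℝ, 1 ≤ t → ∀ v : E,
      |(Nat.card ((t • X) ∩ (v +ᵥ (span ℤ (Set.range b) : Set E)) : Set E) : ℝ) -
          μ.real X / μ.real (fundamentalDomain b) * t ^ finrank ℝ E| ≤
        C * t ^ (finrank ℝ E - 1) := by
  classical
  obtain ⟨C₀, hC₀⟩ := hX₂.exists_cover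
  set M : ℝ := μ.real (closedBall (0 : E) (1 + 2 * cellRadius b)) / μ.real (fundamentalDomain b)
  refine ⟨C₀ * M, fun t ht v ↦ ?_⟩
  have ht0 : 0 ≤ t := zero_le_one.trans ht
  obtain ⟨Y, hYcard, hYcov⟩ := hC₀ t ht
  -- translate the region and the cover by `-v`
  set S : Set E := (-v) +ᵥ (t • X) with hS
  have hS₁ : IsBounded S := (hX₁.smul₀ t).vadd (-v)
  have hSeq : S = (Homeomorph.addLeft (-v)) '' (t • X) := by
    rw [hS, ← Set.image_vadd]
    rfl
  have hYcov' : frontier S ⊆ ⋃ y ∈ Y.image (fun y ↦ -v + y), closedBall y 1 := by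
    intro z hz
    rw [hSeq, ← Homeomorph.image_frontier] at hz
    obtain ⟨x, hx, rfl⟩ := hz
    have hx' := hYcov hx
    simp only [mem_iUnion, exists_prop] at hx' ⊢
    obtain ⟨y, hy, hxy⟩ := hx'
    refine ⟨-v + y, Finset.mem_image.mpr ⟨y, hy, rfl⟩, ?_⟩
    rw [mem_closedBall] at hxy ⊢
    change dist (-v + x) (-v + y) ≤ 1
    simpa using hxy
  have h := abs_card_sub_div_le_of_cover b μ hS₁ hYcov'
  have hμ : μ.real S = t ^ finrank ℝ E * μ.real X := by
    rw [hS, measureReal_def, measure_vadd, Measure.addHaar_smul_of_nonneg μ ht0,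
      ENNReal.toReal_mul, ENNReal.toReal_ofReal (by positivity), measureReal_def]
  rw [hμ] at h
  have hM : 0 ≤ M := div_nonneg measureReal_nonneg measureReal_nonneg
  have hcard' : ((Y.image fun y ↦ -v + y).card : ℝ) ≤ Y.card := by
    exact_mod_cast Finset.card_image_le
  rw [card_inter_vadd_eq]
  calc _ = |(Nat.card (S ∩ (span ℤ (Set.range b) : Set E) : Set E) : ℝ) -
          t ^ finrank ℝ E * μ.real X / μ.real (fundamentalDomain b)| := by rw [hS]; ring_nf
    _ ≤ (Y.image fun y ↦ -v + y).card * M := h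
    _ ≤ Y.card * M := by gcongr
    _ ≤ C₀ * t ^ (finrank ℝ E - 1) * M := by gcongr
    _ = C₀ * M * t ^ (finrank ℝ E - 1) := by ring

variable (L : Submodule ℤ E) [DiscreteTopology L] [IsZLattice ℝ L]

/-- **Points of a coset of a lattice in an expanding domain with Lipschitz-parametrizable
boundary, uniformly in the coset** (Lang, *Algebraic Number Theory*, VI §2, Thm. 2: the number
of points of `L` in `tD + v` is `vol(D)/covol(L) · tⁿ + O(t^{n−1})` uniformly in `v`; Marcus
Ch. 6, Lemma 2 for `v = 0`, `Literature.Algebra.EuclideanLattices.abs_card_inter_smul_sub_le`): for a full lattice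
`L` in `E` and `X` bounded with `(n−1)`-Lipschitz-parametrizable frontier, there is `C` with
`|#((v + L) ∩ tX) − μ(X)/covol(L) · tⁿ| ≤ C t^{n−1}` for all `t ≥ 1` and all `v ∈ E`.
[cite: Marcus2018, Ch. 6, Lemma 2] -/
theorem abs_card_inter_smul_vadd_sub_le {X : Set E} (hX₁ : IsBounded X)
    (hX₂ : LipschitzFrontier X) :
    ∃ C : ℝ, ∀ t : ℝ, 1 ≤ t → ∀ v : E,
      |(Nat.card ((t • X) ∩ (v +ᵥ (L : Set E)) : Set E) : ℝ) -
          μ.real X / ZLattice.covolume L μ * t ^ finrank ℝ E| ≤ C * t ^ (finrank ℝ E - 1) := by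
  set b₀ := Module.Free.chooseBasis ℤ L
  set b := b₀.ofZLatticeBasis ℝ L with hb
  have hspan : span ℤ (Set.range b) = L := b₀.ofZLatticeBasis_span ℝ
  have hcov : ZLattice.covolume L μ = μ.real (fundamentalDomain b) :=
    ZLattice.covolume_eq_measure_fundamentalDomain L μ (ZLattice.isAddFundamentalDomain b₀ μ)
  obtain ⟨C, hC⟩ := abs_card_inter_smul_vadd_sub_le_basis μ b hX₁ hX₂
  refine ⟨C, fun t ht v ↦ ?_⟩
  have := hC t ht v
  rwa [hspan, ← hcov] at this

/-- **Cone form, for cosets**: let `X` be stable under positive scalings and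
`F (r • x) = rⁿ F x` for `r ≥ 0`, `n = dim E`; if `X₁ = {x ∈ X | F x ≤ 1}` is bounded with
`(n−1)`-Lipschitz-parametrizable frontier, then
`|#{x ∈ X ∩ (v + L) | F x ≤ c} − μ(X₁)/covol(L) · c| ≤ C c^{1 − 1/n}` for all `c ≥ 1` and all
`v ∈ E` (compare `Literature.Algebra.EuclideanLattices.abs_card_sep_le_sub_le`, the case `v = 0`).
[cite: Marcus2018, Ch. 6, Lemma 2 and p. 125] -/
theorem abs_card_sep_le_vadd_sub_le {X : Set E}
    (hX : ∀ ⦃x⦄ ⦃r : ℝ⦄, x ∈ X → 0 < r → r • x ∈ X)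
    {F : E → ℝ} (hF : ∀ x ⦃r : ℝ⦄, 0 ≤ r → F (r • x) = r ^ finrank ℝ E * F x)
    (h₁ : IsBounded {x ∈ X | F x ≤ 1}) (h₂ : LipschitzFrontier {x ∈ X | F x ≤ 1}) :
    ∃ C : ℝ, ∀ c : ℝ, 1 ≤ c → ∀ v : E,
      |(Nat.card ({x ∈ X | F x ≤ c} ∩ (v +ᵥ (L : Set E)) : Set E) : ℝ) -
          μ.real {x ∈ X | F x ≤ 1} / ZLattice.covolume L μ * c| ≤
        C * c ^ (1 - 1 / (finrank ℝ E : ℝ)) := by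
  obtain ⟨C, hC⟩ := abs_card_inter_smul_vadd_sub_le μ L h₁ h₂
  refine ⟨C, fun c hc v ↦ ?_⟩
  have hc0 : 0 < c := by linarith
  obtain ⟨m, N, K, f, hm, -, -⟩ := h₂
  set n := finrank ℝ E with hn
  have hn1 : 1 ≤ n := by omega
  have hn0 : (n : ℝ) ≠ 0 := by positivity
  set t : ℝ := c ^ (1 / (n : ℝ)) with ht
  have ht1 : 1 ≤ t := Real.one_le_rpow hc (by positivity)
  have ht0 : 0 < t := by linarith
  have htn : t ^ n = c := by
    rw [ht, ← Real.rpow_natCast, ← Real.rpow_mul hc0.le, one_div_mul_cancel hn0, Real.rpow_one]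
  have htn1 : t ^ (n - 1) = c ^ (1 - 1 / (n : ℝ)) := by
    rw [ht, ← Real.rpow_natCast, ← Real.rpow_mul hc0.le, Nat.cast_sub hn1, Nat.cast_one,
      one_div_mul_eq_div, sub_div, div_self hn0]
  have hset : t • {x ∈ X | F x ≤ 1} = {x ∈ X | F x ≤ c} := by
    ext x
    rw [Set.mem_smul_set_iff_inv_smul_mem₀ ht0.ne', Set.mem_setOf_eq, Set.mem_setOf_eq,
      hF _ (inv_nonneg.2 ht0.le), inv_pow, htn, inv_mul_le_iff₀ hc0, mul_one]
    constructor
    · rintro ⟨h1, h2⟩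
      exact ⟨by simpa [smul_smul, ht0.ne'] using hX h1 ht0, h2⟩
    · rintro ⟨h1, h2⟩
      exact ⟨hX h1 (inv_pos.2 ht0), h2⟩
  have := hC t ht1 v
  rwa [hset, htn, htn1] at this

end Coset

end Literature.Algebra.EuclideanLattices
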